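import Summits.ResolutionOfSingularities.ResolutionOfSingularities.Theorems.FrobeniusLadderFRationalResolutionBlowupFlatCriteria
import Summits.ResolutionOfSingularities.ResolutionOfSingularities.Theorems.FrobeniusLadderFRationalResolutionFlatCoverLocalization
import Mathlib.RingTheory.Localization.Ideal
import HarnessLib

/-!
# Crux `FrobeniusLadder.FRationalResolution` (stmt-ResolutionOfSingularities-15317), line `redirect`,
# stub `stub_diagonalizableQuotientResolution` — a regular blow-up of a DESCENDED centre on a flat chart gives a
# Zariski-local one-blow-up model downstairs

Brick T3 (assembly, given the descended centre) of the repair census. Setting: `Spec B ⊆ X` an affine neighbourhood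
of an ISOLATED singular closed point `𝔭` (so `𝔭` is maximal and every other point of `Spec B` is regular),
`B → C` a flat finitely presented chart (the étale chart `Spec S₀ → X` of the stub, shrunk) whose image contains `𝔭`,
and `I ⊆ B` a `𝔭`-primary centre (`𝔭ⁿ ⊆ I ⊆ 𝔭`; produced from the chart's `𝔪`-primary centre by
`…PrimaryDescent.lean` when the residue field extension is trivial) whose extension `IC` has a REGULAR blow-up
(the chart side: toric resolution of the local model). Then over a basic open `D(h) ∋ 𝔭`:

* `coneModelData_of_flat_chart` — **`(B_h, I B_h, q)` is a one-blow-up model in the exact format of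
  `ConeModels.hloc_of_cone_model` / `hasResolution_of_cone_model_stalks`** (p812121): `I B_h` finitely generated and
  non-zero, `Bl_{I B_h}(Spec B_h)` REGULAR (fpqc descent along the flat surjective `Spec C_h → Spec B_h`,
  `…BlowupFlatCriteria.lean`, `…FlatCoverLocalization.lean`), the regular locus of `Spec B_h` is exactly the
  complement of `V(I B_h)`, and `V(I B_h)` is the single point `q` over `𝔭`.

What remains for the étale-chart case of the stub at an isolated singular point is therefore UPSTAIRS only: the
chart-side regular `𝔪`-primary blow-up (T1 + L3) and the descent of its centre (PrimaryDescent: trivial residue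
extension). Honest label: plumbing (no stub closed). No definitions, no named facts, no sorry.
[folklore; cite: GortzWedhorn2020, Prop. 13.91; StacksProject, Tag 00I1]
-/

noncomputable section

-- single-problem summit: the doubled namespace component is forced
set_option linter.dupNamespace false

open CategoryTheory AlgebraicGeometry TopologicalSpace
open Literature.AlgebraicGeometry.Resolution

namespace Summit.ResolutionOfSingularities.ResolutionOfSingularities.Theorems.FRationalResolution.ChartTransfer

open BlowupFlatCriteria FlatCoverLocalization

universe u

/-- **One-blow-up model downstairs from a regular blow-up of the extended centre upstairs.** Let `B` be a
Noetherian domain, `C` a flat finitely presented `B`-algebra whose spectrum maps onto a neighbourhood of the maximal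
ideal `𝔭`, `I` an ideal with `𝔭ⁿ ⊆ I ⊆ 𝔭`, `I ≠ 0`, such that `Bl_{IC}(Spec C)` is regular; assume `𝔭` is a
singular point of `Spec B` and all other points are regular. Then for some `h ∉ 𝔭`: `I B_h` is finitely generated and
non-zero, `Bl_{I B_h}(Spec B_h)` is regular, a point of `Spec B_h` is regular iff it does not contain `I B_h`, and the
points containing `I B_h` reduce to the single point `q` over `𝔭` — the data of `ConeModels.hloc_of_cone_model`.
[cite: GortzWedhorn2020, Prop. 13.91 (2)] [cite: StacksProject, Tag 00I1] -/
theorem coneModelData_of_flat_chart {B C : Type u} [CommRing B] [CommRing C] [Algebra B C] [IsDomain B]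
    [IsNoetherianRing B] [Module.Flat B C] [Algebra.FinitePresentation B C]
    (𝔭 : Ideal B) [h𝔭 : 𝔭.IsMaximal] (I : Ideal B) (hIfg : I.FG) (hI0 : I ≠ ⊥) {n : ℕ} (hpI : 𝔭 ^ n ≤ I)
    (hIp : I ≤ 𝔭)
    (h𝔭C : (⟨𝔭, h𝔭.isPrime⟩ : PrimeSpectrum B) ∈ Set.range (PrimeSpectrum.comap (algebraMap B C)))
    (hregC : Scheme.IsRegular (affineBlowup (I.map (algebraMap B C))))
    (hsing : (⟨𝔭, h𝔭.isPrime⟩ : Spec (.of B)) ∉ Scheme.regularLocus (Spec (.of B)))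
    (hregB : ∀ P : Spec (.of B), P.asIdeal ≠ 𝔭 → P ∈ Scheme.regularLocus (Spec (.of B))) :
    ∃ h : B, h ∉ 𝔭 ∧
      (I.map (algebraMap B (Localization.Away h))).FG ∧
      I.map (algebraMap B (Localization.Away h)) ≠ ⊥ ∧
      Scheme.IsRegular (affineBlowup (I.map (algebraMap B (Localization.Away h)))) ∧
      (∀ P : Spec (.of (Localization.Away h)),
          P ∈ Scheme.regularLocus (Spec (.of (Localization.Away h))) ↔
            ¬ I.map (algebraMap B (Localization.Away h)) ≤ P.asIdeal) ∧
      ∃ q : Spec (.of (Localization.Away h)),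
        Spec.map (CommRingCat.ofHom (algebraMap B (Localization.Away h))) q = ⟨𝔭, h𝔭.isPrime⟩ ∧
        ∀ t : Spec (.of (Localization.Away h)), I.map (algebraMap B (Localization.Away h)) ≤ t.asIdeal → t = q := by
  classical
  -- a basic open `D(h) ∋ 𝔭` inside the (open) image of the chart
  obtain ⟨h, hh𝔭, hsub⟩ := exists_basicOpen_subset_range_comap B C ⟨𝔭, h𝔭.isPrime⟩ h𝔭C
  set B' := Localization.Away h with hB'
  set C' := Localization.Away (algebraMap B C h) with hC'
  set φ' : B' →+* C' := IsLocalization.Away.map B' C' (algebraMap B C) h with hφ'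
  set I' : Ideal B' := I.map (algebraMap B B') with hI'
  haveI : IsNoetherianRing B' := IsLocalization.isNoetherianRing (Submonoid.powers h) B' inferInstance
  -- the cover `Spec C_h → Spec B_h` is flat and surjective
  have hflat : φ'.Flat :=
    flat_awayMap B C (RingHom.flat_algebraMap_iff.mpr inferInstance) h B' C'
  have hsurj : Function.Surjective (PrimeSpectrum.comap φ') := comap_awayMap_surjective B C h hsub B' C'
  -- upstairs: `Bl_{I C_h}` is an open piece of the regular `Bl_{IC}`
  haveI : IsOpenImmersion (Spec.map (CommRingCat.ofHom (algebraMap C C'))) :=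
    IsOpenImmersion.of_isLocalization (algebraMap B C h)
  have hregC' : Scheme.IsRegular (affineBlowup (I'.map φ')) := by
    have hcomp : φ'.comp (algebraMap B B') = (algebraMap C C').comp (algebraMap B C) := by
      rw [hφ', IsLocalization.Away.map, IsLocalization.map_comp]
    rw [hI', Ideal.map_map, hcomp, ← Ideal.map_map]
    exact isRegular_affineBlowup_map_of_isOpenImmersion (algebraMap C C') _ hregC
  -- fpqc descent
  have hregB' : Scheme.IsRegular (affineBlowup I') :=
    isRegular_affineBlowup_of_flat_of_surjective φ' I' hflat hsurj hregC'
  -- the point over `𝔭`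
  have h𝔭range : (⟨𝔭, h𝔭.isPrime⟩ : PrimeSpectrum B) ∈
      Set.range (PrimeSpectrum.comap (algebraMap B B')) := by
    rw [PrimeSpectrum.localization_away_comap_range B' h]
    exact (PrimeSpectrum.mem_basicOpen _ _).mpr hh𝔭
  obtain ⟨q, hq⟩ := h𝔭range
  have hVI : ∀ t : Spec (.of B'), I' ≤ t.asIdeal → t = q := by
    intro t ht
    apply PrimeSpectrum.localization_comap_injective B' (Submonoid.powers h)
    rw [hq]
    ext1
    exact comap_eq_of_map_le_of_pow_le h B' 𝔭 I hpI t.asIdeal ht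
  -- `B → B_h` is injective, so `I B_h ≠ 0`
  have hh0 : h ≠ 0 := fun h0 => hh𝔭 (h0 ▸ 𝔭.zero_mem)
  have hinj : Function.Injective (algebraMap B B') :=
    IsLocalization.injective B' (powers_le_nonZeroDivisors_of_noZeroDivisors hh0)
  refine ⟨h, hh𝔭, hIfg.map _, ?_, hregB', ?_, q, ?_, hVI⟩
  · intro hbot
    exact hI0 ((Ideal.map_eq_bot_iff_of_injective hinj).mp hbot)
  · intro P
    rw [mem_regularLocus_away_iff h B' P]
    constructor
    · intro hreg hle
      have hPq : P = q := hVI P hle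
      rw [hPq] at hreg
      have : Spec.map (CommRingCat.ofHom (algebraMap B B')) q = ⟨𝔭, h𝔭.isPrime⟩ := hq
      rw [this] at hreg
      exact hsing hreg
    · intro hnle
      apply hregB
      intro heq
      apply hnle
      rw [Ideal.map_le_iff_le_comap]
      intro x hx
      have hx' : x ∈ 𝔭 := hIp hx
      rw [← heq] at hx'
      exact hx'
  · exact hq

end Summit.ResolutionOfSingularities.ResolutionOfSingularities.Theorems.FRationalResolution.ChartTransfer

end
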